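import Mathlib
import HarnessLib
import Summits.NavierStokesRegularity.NavierStokesRegularity.Theorems.HalfSpaceWindowDoorCirculationCarryingRigidityDefs
import Summits.NavierStokesRegularity.NavierStokesRegularity.Theorems.HalfSpaceWindowDoorCirculationCarryingRigidityReduction
import Summits.NavierStokesRegularity.NavierStokesRegularity.Theorems.HalfSpaceWindowDoorCirculationCarryingRigidityCriticalStretchingAnalytic
import Summits.NavierStokesRegularity.NavierStokesRegularity.Theorems.HalfSpaceWindowDoorCirculationCarryingRigidityWindowedFlux
import Literature.Analysis.UnboundedOperators.HeatKernelBoundedData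
import Literature.Analysis.FluidPDE.AxisymNoSwirlVorticity
import Summits.NavierStokesRegularity.NavierStokesRegularity.Theorems.HalfSpaceWindowDoorCirculationCarryingRigidityPlaneFluxDynamics
import Summits.NavierStokesRegularity.NavierStokesRegularity.Theorems.HalfSpaceWindowDoorCirculationCarryingRigidityTiltingIdentity
import Summits.NavierStokesRegularity.NavierStokesRegularity.Theorems.HalfSpaceWindowDoorCirculationCarryingRigidityTiltingFlux
import Literature.Analysis.UnboundedOperators.HeatKernelHeatEquation
import Literature.Analysis.UnboundedOperators.HeatFlowCalculus
import Literature.Analysis.UnboundedOperators.HeatExtensionHarnack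
import Literature.Analysis.UnboundedOperators.HeatKernelGradient
import Literature.Analysis.UnboundedOperators.HeatKernelReversePoincare
import Literature.Analysis.FluidPDE.AxisymNoSwirlImpulseSlice
import Literature.Analysis.FluidPDE.AxisymHouLiVariables
import Literature.Analysis.Calculus.IicRpowTails
import Literature.Analysis.FluidPDE.ConstantinFeffermanStretching
import Summits.NavierStokesRegularity.NavierStokesRegularity.Theorems.PoloidalWindowDoorPoloidalWindowRigidityScrewKinematics
import Summits.NavierStokesRegularity.NavierStokesRegularity.Theorems.HalfSpaceWindowDoorCirculationCarryingRigidityGaussKernel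
import Summits.NavierStokesRegularity.NavierStokesRegularity.Theorems.HalfSpaceWindowDoorCirculationCarryingRigidityGaussCirculation

/-!
# Route `HalfSpaceWindowDoor`, crux `CirculationCarryingRigidity` (stmt-NavierStokesRegularity-25311) — line «gauss-swirl»,
# part `GaussStein`: the angular-momentum density calculus, the SWIRL ALGEBRA
`y₀((DV)V)₁ − y₁((DV)V)₀ = ½[y₀∂₁|V|² − y₁∂₀|V|²] + [y₀F₀ + y₁F₁]` (`swirl_algebra`), the vanishing of the Bernoulli-type term
against the radial Gaussian (`integral_G_swirlGrad_eq_zero`) and the swirl–inflow identity `integral_G_inner_angMom_eq` (uses Stein's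
identity of `…GaussCirculation`)

LINE «gauss-swirl» = ideator ns-idea-4 g11 (D-0145, files-only; critic of record idea-crit-3: PASS, grade new-combination on the wall W6
`…Defs.HemisphereLiouvilleE3`), file of record `pub/ideators/ns-idea-4/lines/gauss-swirl/GaussSwirl_v1_4.lean` (sha16 9f36760ac8cb3b0a,
`lean check` rc 0, sorries 1 = the research statement K1 only), card `LINE-gauss-swirl_v1_4.md`, PORT-MAP.md 5a0f471fb69fa47f.  PORTED
INTO THE TREE by the LEAD of 25311 (ns-hsw-p1 g6, cell pub-ns-dss) as census support `--supports stmt-NavierStokesRegularity-25311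
--as helper`: the proof texts below are the ideator's, VERBATIM modulo the split into ≤ 400-line modules, the `E3 ↦ EuclideanSpace ℝ
(Fin 3)` spelling, the namespace, added one-line docstrings and two `_`-renamings for the unused-variable linter; the vocabulary
(`InDoorClass`, `SignE3`, `gauss`, `angMom`, `gaussAngMom` = 𝒢, `gaussInflow` = ℐ, and the obligation / stratum Props) lives in
`…CirculationCarryingRigidityDefs`.

THE LINE IN ONE PARAGRAPH.  2D one-signed vorticity has the exact law `d/dt∫|x|²ω = 4νΦ`, which alone kills ancient flows with `Φ > 0`;
in the 3D closed hemisphere (`ω₃ ≥ 0`) it survives for the GAUSSIAN AXIAL ANGULAR MOMENTUM `𝒢(t;x₀) = t^{-3/2}∫e^{−|x−x₀|²/4t} g`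
(`= 2t^{-1/2}∫e^{…}ω₃ ≥ 0`), because against the divergence-free Gaussian swirl field `K_t(x−x₀)·e₃×(x−x₀)` pressure AND vortex tilting
drop out exactly, leaving ONE signed residue, the inflow correlation `ℐ = t^{-3/2}∫e^{…}((x−x₀)·v) g`: `d𝒢/ds = −𝒢/(s₀−s) − ℐ/(2(s₀−s))`;
with the time-only Type-I rate `𝒢/(s₀−s) → 0` in the far past, so «no inflow about ONE space–time axis before some epoch ⇒ poloidal».

WHAT THIS IS NOT: not a statement about Navier–Stokes regularity (Clay A).  The door statements are regularity CRITERIA about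
HYPOTHETICAL blow-up profiles (KNSS ancient mild solutions); the research statement K1 `PersistentAxis` (⟺ the wall) is NOT proved,
NOT registered and nothing is closed by this file; item 25311 stays OPEN at its research stub.
-/

noncomputable section

-- the summit and its single sub-problem share the name (CONVENTIONS §1), as in every Theorems file
set_option linter.dupNamespace false

namespace Summit.NavierStokesRegularity.NavierStokesRegularity.Theorems.HalfSpaceWindowDoorCirculationCarryingRigidityGaussStein


open scoped BigOperators Topology MeasureTheory InnerProductSpace RealInnerProductSpace Laplacian ContDiff
open Filter Set Function MeasureTheory Metric
open Literature.Analysis Literature.Analysis.FluidPDE Literature.Analysis.UnboundedOperators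
open Summit.NavierStokesRegularity.NavierStokesRegularity.Theses.HalfSpaceWindowDoor
open Summit.NavierStokesRegularity.NavierStokesRegularity.Theorems.HalfSpaceWindowDoorCirculationCarryingRigidityDefs
open Summit.NavierStokesRegularity.NavierStokesRegularity.Theorems.HalfSpaceWindowDoorCirculationCarryingRigidityReduction
  (circulationCarryingRigidity_of_hemisphereLiouvilleE3)
open Summit.NavierStokesRegularity.NavierStokesRegularity.Theorems.HalfSpaceWindowDoorCirculationCarryingRigidityCriticalStretchingAnalytic
  (inner_curl_e3_eq_zero_of_far_past)
open Summit.NavierStokesRegularity.NavierStokesRegularity.Theorems.LocalSineTubeDoorProfileAlignedWindowRigidityAncient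
  (bdd_of_hasTypeITimeDecay analyticOnNhd_slice)
open Summit.NavierStokesRegularity.NavierStokesRegularity.Theorems.PoloidalWindowDoorPoloidalWindowRigidityClassSpaceTimeRates
  (exists_fderiv_rate_of_class' exists_iteratedFDeriv_two_rate_of_class' exists_iteratedFDeriv_three_rate_of_class)
open Summit.NavierStokesRegularity.NavierStokesRegularity.Theorems.HalfSpaceWindowDoorCirculationCarryingRigidityPlaneFluxDynamics
  (hasDerivAt_inner_curl_e3_convect)
open Summit.NavierStokesRegularity.NavierStokesRegularity.Theorems.HalfSpaceWindowDoorCirculationCarryingRigidityTiltingIdentity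
  (convect_sub_stretch_two_eq_divh)
open Summit.NavierStokesRegularity.NavierStokesRegularity.Theorems.HalfSpaceWindowDoorCirculationCarryingRigidityTiltingFlux
  (contDiff_flux norm_flux_le norm_fderiv_flux_le)
open Summit.NavierStokesRegularity.NavierStokesRegularity.Theorems.HalfSpaceWindowDoorCirculationCarryingRigiditySubcriticalStretching
  (hasDerivAt_inner_curl_e3 fderiv_inner_e3_apply laplacian_inner_e3)
open Summit.NavierStokesRegularity.NavierStokesRegularity.Theorems.HalfSpaceWindowDoorCirculationCarryingRigidityPlaneFluxHeightWindow
  (abs_inner_e3_le contDiff_one_curl)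
open Summit.NavierStokesRegularity.NavierStokesRegularity.Theorems.HalfSpaceWindowDoorCirculationCarryingRigidityPlaneLaplacian
  (contDiff_two_curl norm_iteratedFDeriv_two_inner_e3_le)
open Summit.NavierStokesRegularity.NavierStokesRegularity.Theorems.ChiralWindowDoorClassDerivDecay (exists_classical_of_class)
open Summit.NavierStokesRegularity.NavierStokesRegularity.Theorems.PoloidalWindowDoorPoloidalWindowRigidityScrewKinematics (inner_eq_three)
open Summit.NavierStokesRegularity.NavierStokesRegularity.Theorems.HalfSpaceWindowDoorCirculationCarryingRigidityGaussKernel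
open Summit.NavierStokesRegularity.NavierStokesRegularity.Theorems.HalfSpaceWindowDoorCirculationCarryingRigidityGaussCirculation

section Swirl
variable {V : (EuclideanSpace ℝ (Fin 3)) → (EuclideanSpace ℝ (Fin 3))} {t : ℝ} (x₀ : (EuclideanSpace ℝ (Fin 3)))

/-- Derivative of the angular-momentum density `g = (x−x₀)₀V₁ − (x−x₀)₁V₀`. -/
theorem hasFDerivAt_angMom (hV : Differentiable ℝ V) (x : (EuclideanSpace ℝ (Fin 3))) :
    HasFDerivAt (angMom x₀ V)
      ((x - x₀) 0 • fderiv ℝ (fun y => V y 1) x + V x 1 • EuclideanSpace.proj (𝕜 := ℝ) (0 : Fin 3) -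
        ((x - x₀) 1 • fderiv ℝ (fun y => V y 0) x + V x 0 • EuclideanSpace.proj (𝕜 := ℝ) (1 : Fin 3))) x := by
  have h0 := hasFDerivAt_coord x₀ x 0
  have h1 := hasFDerivAt_coord x₀ x 1
  have hV1 := (differentiable_apply3 hV 1 x).hasFDerivAt
  have hV0 := (differentiable_apply3 hV 0 x).hasFDerivAt
  exact (h0.mul hV1).sub (h1.mul hV0)

/-- The derivative of the angular-momentum density applied to a vector. -/
theorem fderiv_angMom_apply (hV : Differentiable ℝ V) (x w : (EuclideanSpace ℝ (Fin 3))) :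
    fderiv ℝ (angMom x₀ V) x w =
      (x - x₀) 0 * fderiv ℝ V x w 1 + V x 1 * w 0 - ((x - x₀) 1 * fderiv ℝ V x w 0 + V x 0 * w 1) := by
  rw [(hasFDerivAt_angMom x₀ hV x).fderiv]
  simp only [sub_apply, add_apply, smul_apply, smul_eq_mul, fderiv_apply3 hV]
  rfl

/-- The angular-momentum density of a `C¹` field is `C¹`. -/
theorem contDiff_angMom (hV : ContDiff ℝ 1 V) : ContDiff ℝ 1 (angMom x₀ V) := by
  have hc : ∀ i : Fin 3, ContDiff ℝ 1 (fun y : (EuclideanSpace ℝ (Fin 3)) => (y - x₀) i) := fun i =>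
    (EuclideanSpace.proj (𝕜 := ℝ) i).contDiff.comp (contDiff_id.sub contDiff_const)
  exact ((hc 0).mul (contDiff_apply3 hV 1)).sub ((hc 1).mul (contDiff_apply3 hV 0))

/-- Linear-growth bound for the gradient of the angular-momentum density. -/
theorem norm_fderiv_angMom_le (hV : Differentiable ℝ V) {B M : ℝ} (hB : ∀ x, ‖V x‖ ≤ B)
    (hM : ∀ x, ‖fderiv ℝ V x‖ ≤ M) (x : (EuclideanSpace ℝ (Fin 3))) : ‖fderiv ℝ (angMom x₀ V) x‖ ≤ 2 * B + 2 * M * ‖x - x₀‖ := by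
  have hB0 : 0 ≤ B := (norm_nonneg _).trans (hB x₀)
  have hM0 : 0 ≤ M := (norm_nonneg _).trans (hM x₀)
  refine ContinuousLinearMap.opNorm_le_bound _ (by positivity) fun w => ?_
  rw [fderiv_angMom_apply x₀ hV, Real.norm_eq_abs]
  have hy : ∀ i, |(x - x₀) i| ≤ ‖x - x₀‖ := fun i => abs_coord_le_norm_e3 _ i
  have hw : ∀ i, |w i| ≤ ‖w‖ := fun i => abs_coord_le_norm_e3 _ i
  have hv : ∀ i, |V x i| ≤ B := fun i => (abs_coord_le_norm_e3 _ i).trans (hB x)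
  have hD : ∀ i, |fderiv ℝ V x w i| ≤ M * ‖w‖ := fun i =>
    (abs_coord_le_norm_e3 _ i).trans ((ContinuousLinearMap.le_opNorm _ _).trans (mul_le_mul_of_nonneg_right (hM x) (norm_nonneg _)))
  calc |(x - x₀) 0 * fderiv ℝ V x w 1 + V x 1 * w 0 - ((x - x₀) 1 * fderiv ℝ V x w 0 + V x 0 * w 1)|
      ≤ |(x - x₀) 0 * fderiv ℝ V x w 1 + V x 1 * w 0| + |(x - x₀) 1 * fderiv ℝ V x w 0 + V x 0 * w 1| := abs_sub _ _
    _ ≤ (|(x - x₀) 0 * fderiv ℝ V x w 1| + |V x 1 * w 0|) + (|(x - x₀) 1 * fderiv ℝ V x w 0| + |V x 0 * w 1|) :=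
        add_le_add (abs_add_le _ _) (abs_add_le _ _)
    _ = (|(x - x₀) 0| * |fderiv ℝ V x w 1| + |V x 1| * |w 0|) + (|(x - x₀) 1| * |fderiv ℝ V x w 0| + |V x 0| * |w 1|) := by
        simp only [abs_mul]
    _ ≤ (‖x - x₀‖ * (M * ‖w‖) + B * ‖w‖) + (‖x - x₀‖ * (M * ‖w‖) + B * ‖w‖) :=
        add_le_add
          (add_le_add (mul_le_mul (hy 0) (hD 1) (abs_nonneg _) (norm_nonneg _))
            (mul_le_mul (hv 1) (hw 0) (abs_nonneg _) hB0))
          (add_le_add (mul_le_mul (hy 1) (hD 0) (abs_nonneg _) (norm_nonneg _))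
            (mul_le_mul (hv 0) (hw 1) (abs_nonneg _) hB0))
    _ = (2 * B + 2 * M * ‖x - x₀‖) * ‖w‖ := by ring

/-- **Pointwise swirl algebra** (`(v·∇)v = ∇|v|²/2 − v × ω`, third component of `y × ·`):
`y₀((DV)V)₁ − y₁((DV)V)₀ = [y₀Q₁ − y₁Q₀] + [y₀F₀ + y₁F₁]`, `Q_k = Σᵢ Vᵢ ∂ₖVᵢ`, `Fⱼ = Vⱼω₂ − ωⱼV₂`. -/
theorem swirl_algebra (V : (EuclideanSpace ℝ (Fin 3)) → (EuclideanSpace ℝ (Fin 3))) (x : (EuclideanSpace ℝ (Fin 3))) :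
    (x - x₀) 0 * fderiv ℝ V x (V x) 1 - (x - x₀) 1 * fderiv ℝ V x (V x) 0 =
      ((x - x₀) 0 * (V x 0 * fderiv ℝ V x (EuclideanSpace.single 1 1) 0 + V x 1 * fderiv ℝ V x (EuclideanSpace.single 1 1) 1 +
            V x 2 * fderiv ℝ V x (EuclideanSpace.single 1 1) 2) -
        (x - x₀) 1 * (V x 0 * fderiv ℝ V x (EuclideanSpace.single 0 1) 0 + V x 1 * fderiv ℝ V x (EuclideanSpace.single 0 1) 1 +
            V x 2 * fderiv ℝ V x (EuclideanSpace.single 0 1) 2)) +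
      ((x - x₀) 0 * (V x 0 * curl V x 2 - curl V x 0 * V x 2) + (x - x₀) 1 * (V x 1 * curl V x 2 - curl V x 1 * V x 2)) := by
  have hexp : ∀ k : Fin 3, fderiv ℝ V x (V x) k = V x 0 * fderiv ℝ V x (EuclideanSpace.single 0 1) k +
      V x 1 * fderiv ℝ V x (EuclideanSpace.single 1 1) k + V x 2 * fderiv ℝ V x (EuclideanSpace.single 2 1) k := by
    intro k
    rw [clm_apply_eq_sum3 (fderiv ℝ V x) (V x)]
    simp only [PiLp.add_apply, PiLp.smul_apply, smul_eq_mul]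
  rw [hexp 1, hexp 0, curl_apply_zero_eq_sub, curl_apply_one_eq_sub, curl_apply_two]
  ring

/-- **The pressure-type term integrates to zero**: `∫ G [y₀ ∂₁P − y₁ ∂₀P] = 0` for a bounded `C¹` scalar `P` with bounded
gradient (`∂₁(y₀P) = y₀∂₁P`, one integration by parts each, `yⱼ∂ₖG` symmetric in `j,k`). -/
theorem integral_G_swirlGrad_eq_zero {P : (EuclideanSpace ℝ (Fin 3)) → ℝ} (hP : ContDiff ℝ 1 P) {C₀ C₁ : ℝ} (h0 : ∀ x, ‖P x‖ ≤ C₀)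
    (h1 : ∀ x, ‖fderiv ℝ P x‖ ≤ C₁) (ht : 0 < t) :
    Integrable (fun x => heatKernel t (x - x₀) *
      ((x - x₀) 0 * fderiv ℝ P x (EuclideanSpace.single 1 1) - (x - x₀) 1 * fderiv ℝ P x (EuclideanSpace.single 0 1))) ∧
    ∫ x, heatKernel t (x - x₀) *
      ((x - x₀) 0 * fderiv ℝ P x (EuclideanSpace.single 1 1) - (x - x₀) 1 * fderiv ℝ P x (EuclideanSpace.single 0 1)) = 0 := by
  have hPd : Differentiable ℝ P := hP.differentiable one_ne_zero
  have hC0 : 0 ≤ C₀ := (norm_nonneg _).trans (h0 x₀)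
  have hC1 : 0 ≤ C₁ := (norm_nonneg _).trans (h1 x₀)
  have hc : ∀ i : Fin 3, ContDiff ℝ 1 (fun y : (EuclideanSpace ℝ (Fin 3)) => (y - x₀) i) := fun i =>
    (EuclideanSpace.proj (𝕜 := ℝ) i).contDiff.comp (contDiff_id.sub contDiff_const)
  -- φᵢ = yᵢ P
  set φ : Fin 3 → (EuclideanSpace ℝ (Fin 3)) → ℝ := fun i y => (y - x₀) i * P y with hφ
  have hφ1 : ∀ i, ContDiff ℝ 1 (φ i) := fun i => (hc i).mul hP
  have hφ0 : ∀ i x, ‖φ i x‖ ≤ 0 + C₀ * ‖x - x₀‖ := by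
    intro i x
    rw [hφ]; simp only [norm_mul, Real.norm_eq_abs, zero_add]
    calc |(x - x₀) i| * |P x| ≤ ‖x - x₀‖ * C₀ :=
          mul_le_mul (abs_coord_le_norm_e3 _ i) (by simpa [Real.norm_eq_abs] using h0 x) (abs_nonneg _) (norm_nonneg _)
      _ = C₀ * ‖x - x₀‖ := mul_comm _ _
  have hφf : ∀ i x, fderiv ℝ (φ i) x = (x - x₀) i • fderiv ℝ P x + P x • EuclideanSpace.proj (𝕜 := ℝ) i := by
    intro i x
    rw [hφ]; exact ((hasFDerivAt_coord x₀ x i).mul (hPd x).hasFDerivAt).fderiv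
  have hφD : ∀ i x, ‖fderiv ℝ (φ i) x‖ ≤ C₀ + C₁ * ‖x - x₀‖ := by
    intro i x
    rw [hφf]
    calc ‖(x - x₀) i • fderiv ℝ P x + P x • EuclideanSpace.proj (𝕜 := ℝ) i‖
        ≤ ‖(x - x₀) i • fderiv ℝ P x‖ + ‖P x • EuclideanSpace.proj (𝕜 := ℝ) i‖ := norm_add_le _ _
      _ ≤ ‖x - x₀‖ * C₁ + C₀ * 1 := by
          rw [norm_smul, norm_smul, Real.norm_eq_abs]
          refine add_le_add (mul_le_mul (abs_coord_le_norm_e3 _ i) (h1 x) (norm_nonneg _) (norm_nonneg _))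
            (mul_le_mul (h0 x) ?_ (norm_nonneg _) hC0)
          refine ContinuousLinearMap.opNorm_le_bound _ zero_le_one fun w => ?_
          rw [one_mul]; exact PiLp.norm_apply_le w i
      _ = C₀ + C₁ * ‖x - x₀‖ := by ring
  have hφa : ∀ (i j : Fin 3) (x : (EuclideanSpace ℝ (Fin 3))), i ≠ j → fderiv ℝ (φ i) x (EuclideanSpace.single j 1) =
      (x - x₀) i * fderiv ℝ P x (EuclideanSpace.single j 1) := by
    intro i j x hij
    rw [hφf]
    simp only [add_apply, smul_apply, smul_eq_mul]
    have : (EuclideanSpace.proj (𝕜 := ℝ) i : (EuclideanSpace ℝ (Fin 3)) →L[ℝ] ℝ) (EuclideanSpace.single j (1 : ℝ)) = 0 := by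
      simp [hij]
    rw [this, mul_zero, add_zero]
  obtain ⟨IA, IB, IE⟩ := integral_G_mul_fderiv_eq_lin x₀ (hφ1 0) (hφ0 0) (hφD 0) ht 1
  obtain ⟨JA, JB, JE⟩ := integral_G_mul_fderiv_eq_lin x₀ (hφ1 1) (hφ0 1) (hφD 1) ht 0
  have h01 : (0 : Fin 3) ≠ 1 := by decide
  have h10 : (1 : Fin 3) ≠ 0 := by decide
  simp only [hφa 0 1 _ h01] at IA IE
  simp only [hφa 1 0 _ h10] at JA JE
  -- the two boundary-free right-hand sides coincide
  have hRHS : ∫ x, fderiv ℝ (fun y : (EuclideanSpace ℝ (Fin 3)) => heatKernel t (y - x₀)) x (EuclideanSpace.single 1 1) * φ 0 x =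
      ∫ x, fderiv ℝ (fun y : (EuclideanSpace ℝ (Fin 3)) => heatKernel t (y - x₀)) x (EuclideanSpace.single 0 1) * φ 1 x := by
    congr 1; funext x
    rw [fderiv_G_apply, fderiv_G_apply, hφ]
    ring
  refine ⟨?_, ?_⟩
  · have : (fun x => heatKernel t (x - x₀) *
        ((x - x₀) 0 * fderiv ℝ P x (EuclideanSpace.single 1 1) - (x - x₀) 1 * fderiv ℝ P x (EuclideanSpace.single 0 1))) =
        fun x => heatKernel t (x - x₀) * ((x - x₀) 0 * fderiv ℝ P x (EuclideanSpace.single 1 1)) -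
          heatKernel t (x - x₀) * ((x - x₀) 1 * fderiv ℝ P x (EuclideanSpace.single 0 1)) := by
      funext x; ring
    rw [this]; exact IA.sub JA
  · have : (fun x => heatKernel t (x - x₀) *
        ((x - x₀) 0 * fderiv ℝ P x (EuclideanSpace.single 1 1) - (x - x₀) 1 * fderiv ℝ P x (EuclideanSpace.single 0 1))) =
        fun x => heatKernel t (x - x₀) * ((x - x₀) 0 * fderiv ℝ P x (EuclideanSpace.single 1 1)) -
          heatKernel t (x - x₀) * ((x - x₀) 1 * fderiv ℝ P x (EuclideanSpace.single 0 1)) := by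
      funext x; ring
    rw [this, integral_sub IA JA, IE, JE, hRHS, sub_self]

/-- **THE GAUSSIAN SWIRL–INFLOW IDENTITY (kinematic; dictionary row O1b).**  For a bounded `C¹` divergence-free field
`V` on `ℝ³` with bounded gradient, `t > 0`, `x₀ ∈ ℝ³`, `y = x − x₀`, `g = y₀V₁ − y₁V₀`, `ω = curl V`,
`Fⱼ = Vⱼω₂ − ωⱼV₂`:  `∫ G_t(y) ⟪y, V⟫ g dx = 2t ∫ G_t(y) [y₀F₀ + y₁F₁] dx`.
Proof: Stein along `V` (`div V = 0`) gives `2t∫G Dg[V]`; `Dg[V] = y₀((DV)V)₁ − y₁((DV)V)₀`; the swirl algebra splits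
this into the swirl-derivative of `|V|²/2` (which integrates to zero against the radial Gaussian) plus `y₀F₀ + y₁F₁`. -/
theorem integral_G_inner_angMom_eq (hV : ContDiff ℝ 1 V) {B M : ℝ} (hB : ∀ x, ‖V x‖ ≤ B)
    (hM : ∀ x, ‖fderiv ℝ V x‖ ≤ M) (hdiv : VectorCalculus.IsDivFree V) (ht : 0 < t) :
    Integrable (fun x => heatKernel t (x - x₀) * (⟪x - x₀, V x⟫_ℝ * angMom x₀ V x)) ∧
    Integrable (fun x => heatKernel t (x - x₀) *
      ((x - x₀) 0 * (V x 0 * curl V x 2 - curl V x 0 * V x 2) + (x - x₀) 1 * (V x 1 * curl V x 2 - curl V x 1 * V x 2))) ∧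
    ∫ x, heatKernel t (x - x₀) * (⟪x - x₀, V x⟫_ℝ * angMom x₀ V x) =
      2 * t * ∫ x, heatKernel t (x - x₀) *
        ((x - x₀) 0 * (V x 0 * curl V x 2 - curl V x 0 * V x 2) + (x - x₀) 1 * (V x 1 * curl V x 2 - curl V x 1 * V x 2)) := by
  have hVd : Differentiable ℝ V := hV.differentiable one_ne_zero
  have hB0 : 0 ≤ B := (norm_nonneg _).trans (hB x₀)
  have hM0 : 0 ≤ M := (norm_nonneg _).trans (hM x₀)
  -- Stein along V with φ = g
  have hg0 : ∀ x, ‖angMom x₀ V x‖ ≤ 0 + 2 * B * ‖x - x₀‖ := fun x => by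
    rw [Real.norm_eq_abs, zero_add]
    calc |angMom x₀ V x| ≤ 2 * ‖x - x₀‖ * ‖V x‖ := abs_angMom_le x₀ V x
      _ ≤ 2 * ‖x - x₀‖ * B := mul_le_mul_of_nonneg_left (hB x) (by positivity)
      _ = 2 * B * ‖x - x₀‖ := by ring
  obtain ⟨I1, I2, E1⟩ := integral_G_inner_mul_eq x₀ hV hB hM hdiv (contDiff_angMom x₀ hV) hg0
    (norm_fderiv_angMom_le x₀ hVd hB hM) ht
  -- P = |V|², bounded C¹ with bounded gradient, and DP w = 2 Σ Vᵢ (DV w)ᵢ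
  set P : (EuclideanSpace ℝ (Fin 3)) → ℝ := fun x => ‖V x‖ ^ 2 with hP
  have hP1 : ContDiff ℝ 1 P := by rw [hP]; exact hV.norm_sq ℝ
  have hPf : ∀ x w, fderiv ℝ P x w = 2 * (V x 0 * fderiv ℝ V x w 0 + V x 1 * fderiv ℝ V x w 1 + V x 2 * fderiv ℝ V x w 2) := by
    intro x w
    rw [hP, ((hVd x).hasFDerivAt.norm_sq).fderiv]
    simp only [smul_apply, ContinuousLinearMap.comp_apply, innerSL_apply_apply,
      inner_eq_three, nsmul_eq_mul, Nat.cast_ofNat]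
  have hP0 : ∀ x, ‖P x‖ ≤ B ^ 2 := fun x => by
    rw [hP, Real.norm_of_nonneg (by positivity)]
    exact pow_le_pow_left₀ (norm_nonneg _) (hB x) 2
  have hPD : ∀ x, ‖fderiv ℝ P x‖ ≤ 2 * B * M := by
    intro x
    rw [hP, ((hVd x).hasFDerivAt.norm_sq).fderiv]
    calc ‖(2 : ℕ) • (innerSL ℝ (V x)).comp (fderiv ℝ V x)‖ ≤ 2 * ‖(innerSL ℝ (V x)).comp (fderiv ℝ V x)‖ := by
          simpa using (norm_nsmul_le (n := 2) (a := (innerSL ℝ (V x)).comp (fderiv ℝ V x)))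
      _ ≤ 2 * (‖innerSL ℝ (V x)‖ * ‖fderiv ℝ V x‖) :=
          mul_le_mul_of_nonneg_left (ContinuousLinearMap.opNorm_comp_le _ _) (by norm_num)
      _ ≤ 2 * (B * M) := by
          rw [innerSL_apply_norm]
          exact mul_le_mul_of_nonneg_left (mul_le_mul (hB x) (hM x) (norm_nonneg _) hB0) (by norm_num)
      _ = 2 * B * M := by ring
  obtain ⟨J1, J0⟩ := integral_G_swirlGrad_eq_zero x₀ hP1 hP0 hPD ht
  -- pointwise: G · Dg[V] = G · (½ swirl-grad P) + G · (y₀F₀ + y₁F₁)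
  have hptw : ∀ x, heatKernel t (x - x₀) * fderiv ℝ (angMom x₀ V) x (V x) =
      (1 / 2 : ℝ) * (heatKernel t (x - x₀) *
        ((x - x₀) 0 * fderiv ℝ P x (EuclideanSpace.single 1 1) - (x - x₀) 1 * fderiv ℝ P x (EuclideanSpace.single 0 1))) +
      heatKernel t (x - x₀) *
        ((x - x₀) 0 * (V x 0 * curl V x 2 - curl V x 0 * V x 2) + (x - x₀) 1 * (V x 1 * curl V x 2 - curl V x 1 * V x 2)) := by
    intro x
    rw [fderiv_angMom_apply x₀ hVd, hPf, hPf]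
    have halg := swirl_algebra x₀ V x
    linear_combination (heatKernel t (x - x₀)) * halg
  have IF : Integrable (fun x => heatKernel t (x - x₀) *
      ((x - x₀) 0 * (V x 0 * curl V x 2 - curl V x 0 * V x 2) + (x - x₀) 1 * (V x 1 * curl V x 2 - curl V x 1 * V x 2))) := by
    have : (fun x => heatKernel t (x - x₀) *
        ((x - x₀) 0 * (V x 0 * curl V x 2 - curl V x 0 * V x 2) + (x - x₀) 1 * (V x 1 * curl V x 2 - curl V x 1 * V x 2))) =
        fun x => heatKernel t (x - x₀) * fderiv ℝ (angMom x₀ V) x (V x) -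
          (1 / 2 : ℝ) * (heatKernel t (x - x₀) *
            ((x - x₀) 0 * fderiv ℝ P x (EuclideanSpace.single 1 1) - (x - x₀) 1 * fderiv ℝ P x (EuclideanSpace.single 0 1))) := by
      funext x; rw [hptw x]; ring
    rw [this]
    exact I2.sub (J1.const_mul _)
  refine ⟨I1, IF, ?_⟩
  rw [E1]
  congr 1
  calc ∫ x, heatKernel t (x - x₀) * fderiv ℝ (angMom x₀ V) x (V x)
      = ∫ x, (1 / 2 : ℝ) * (heatKernel t (x - x₀) *
          ((x - x₀) 0 * fderiv ℝ P x (EuclideanSpace.single 1 1) - (x - x₀) 1 * fderiv ℝ P x (EuclideanSpace.single 0 1))) +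
        heatKernel t (x - x₀) *
          ((x - x₀) 0 * (V x 0 * curl V x 2 - curl V x 0 * V x 2) + (x - x₀) 1 * (V x 1 * curl V x 2 - curl V x 1 * V x 2)) :=
        integral_congr_ae (ae_of_all _ hptw)
    _ = (1 / 2 : ℝ) * (∫ x, heatKernel t (x - x₀) *
          ((x - x₀) 0 * fderiv ℝ P x (EuclideanSpace.single 1 1) - (x - x₀) 1 * fderiv ℝ P x (EuclideanSpace.single 0 1))) +
        ∫ x, heatKernel t (x - x₀) *
          ((x - x₀) 0 * (V x 0 * curl V x 2 - curl V x 0 * V x 2) + (x - x₀) 1 * (V x 1 * curl V x 2 - curl V x 1 * V x 2)) := by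
        rw [integral_add (J1.const_mul _) IF, integral_const_mul]
    _ = _ := by rw [J0, mul_zero, zero_add]

end Swirl

end Summit.NavierStokesRegularity.NavierStokesRegularity.Theorems.HalfSpaceWindowDoorCirculationCarryingRigidityGaussStein

end
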